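import Summits.NavierStokesRegularity.FunctionalMining.LatticeTrilinear
import HarnessLib

/-!
# FunctionalMining — the lattice product law on `ℤ³` at general exponents (bilinear form)

Search for candidate a priori estimates; no regularity claim. Cell `pub-nsfunc`, prove seat
(gen 12). The bilinear (duality) form of the lattice trilinear estimate
`LatticeTrilinear.sq_tsum_tsum_conv_mul_le`: for nonnegative families `a, b : ℤ³ → [0, ∞]` vanishing
at the origin and exponents `t₁, t₂ < 3/2` with `t₁ + t₂ > 0`,

`∑_{k ≠ 0} σ_{t₁+t₂−3/2}(k) (∑_j a(k−j) b(j))² ≤ K (∑ σ_{t₁} a²) (∑ σ_{t₂} b²)`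

(`tsum_indicator_conv_sq_le`; `σ_t(m) = (4π²|m|²)^t`), i.e. `‖fg‖_{Ḣ^{t₁+t₂−3/2}} ≲ ‖f‖_{Ḣ^{t₁}} ‖g‖_{Ḣ^{t₂}}`
for mean-free `f, g` on `T³` read on Fourier majorants — the general-exponent version of the tree's
`Lattice.tsum_weight_mul_conv_sq_le` (the case `t₁ = t₂ = 1`; Bahouri–Chemin–Danchin 2011,
Cor. 2.55). Proof: test the trilinear estimate against `c = σ_{t₁+t₂−3/2} · min(a ⋆ b, M)` restricted
to a finite set of frequencies, cancel the finite truncated sum, and take suprema (monotone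
convergence); no finiteness hypotheses are needed.
-/

noncomputable section

open MeasureTheory Set Filter Topology Real
open scoped ENNReal NNReal

namespace Summit.NavierStokesRegularity.FunctionalMining

namespace LatticeTrilinear

open Literature.Analysis.FunctionSpaces.Torus Literature.Analysis.FluidPDE.Torus

variable {d : Type*} [Fintype d]

omit [Fintype d] in
/-- `⨆_{M : ℝ≥0} min(x, M)² = x²` in `ℝ≥0∞`. [folklore] -/
theorem iSup_min_coe_sq (x : ℝ≥0∞) : ⨆ M : ℝ≥0, (min x (M : ℝ≥0∞)) ^ 2 = x ^ 2 := by
  refine le_antisymm (iSup_le fun M => pow_le_pow_left' (min_le_left _ _) 2) ?_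
  rcases eq_or_ne x ∞ with rfl | hx
  · -- `x = ⊤`: the truncations are unbounded
    rw [ENNReal.top_pow two_ne_zero, top_le_iff]
    refine ENNReal.eq_top_of_forall_nnreal_le fun r => ?_
    have h1 : (1 : ℝ≥0∞) ≤ ((max r 1 : ℝ≥0) : ℝ≥0∞) := by exact_mod_cast le_max_right r 1
    have hr : (r : ℝ≥0∞) ≤ ((max r 1 : ℝ≥0) : ℝ≥0∞) := by exact_mod_cast le_max_left r 1
    calc (r : ℝ≥0∞) = r * 1 := (mul_one _).symm
      _ ≤ (max r 1 : ℝ≥0) * (max r 1 : ℝ≥0) := mul_le_mul' hr h1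
      _ = (min ⊤ ((max r 1 : ℝ≥0) : ℝ≥0∞)) ^ 2 := by rw [min_eq_right le_top, sq]
      _ ≤ ⨆ M : ℝ≥0, (min ⊤ (M : ℝ≥0∞)) ^ 2 := le_iSup_of_le (max r 1) le_rfl
  · refine le_iSup_of_le x.toNNReal ?_
    rw [ENNReal.coe_toNNReal hx, min_self]

/-- `σ_{−t}(k) σ_t(k) = 1` off the origin. [folklore] -/
theorem fracSymbol_neg_mul_self {k : d → ℤ} (hk : k ≠ 0) (t : ℝ) : fracSymbol (-t) k * fracSymbol t k = 1 := by
  rw [← fracSymbol_inv_eq hk t, inv_mul_cancel₀ (fracSymbol_pos_of_ne_zero hk t).ne']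

/-- **The lattice product law on `ℤ³` at general exponents** (bilinear form of the trilinear
estimate). Let `card d = 3`, `t₁, t₂ < 3/2`, `t₁ + t₂ > 0`. There is `K ≥ 0` such that for all
`a b : ℤ³ → [0, ∞]` vanishing at the origin,
`∑_{k ≠ 0} σ_{t₁+t₂−3/2}(k) (∑_j a(k−j) b(j))² ≤ K (∑ σ_{t₁} a²)(∑ σ_{t₂} b²)` — the Fourier-majorant
form of `Ḣ^{t₁}·Ḣ^{t₂} ⊂ Ḣ^{t₁+t₂−3/2}` on `T³`. [folklore; Bahouri–Chemin–Danchin 2011 Cor. 2.55] -/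
theorem tsum_indicator_conv_sq_le (hd : Fintype.card d = 3) {t₁ t₂ : ℝ} (ht₁ : t₁ < 3 / 2)
    (ht₂ : t₂ < 3 / 2) (h12 : 0 < t₁ + t₂) :
    ∃ K : ℝ, 0 ≤ K ∧ ∀ a b : (d → ℤ) → ℝ≥0∞, a 0 = 0 → b 0 = 0 →
      ∑' k : d → ℤ, ({k : d → ℤ | k ≠ 0}).indicator
          (fun k => ENNReal.ofReal (fracSymbol (t₁ + t₂ - 3 / 2) k) * (∑' j, a (k - j) * b j) ^ 2) k ≤
        ENNReal.ofReal K * (∑' m, ENNReal.ofReal (fracSymbol t₁ m) * a m ^ 2) *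
          (∑' m, ENNReal.ofReal (fracSymbol t₂ m) * b m ^ 2) := by
  classical
  obtain ⟨K, hK, hT⟩ := sq_tsum_tsum_conv_mul_le hd ht₁ ht₂ (t₃ := 3 / 2 - t₁ - t₂) (by linarith) (by ring)
  refine ⟨K, hK, fun a b ha hb => ?_⟩
  set σ : ℝ := t₁ + t₂ - 3 / 2 with hσ
  have hσ' : 3 / 2 - t₁ - t₂ = -σ := by rw [hσ]; ring
  rw [hσ'] at hT
  set N₁ := ∑' m, ENNReal.ofReal (fracSymbol t₁ m) * a m ^ 2 with hN₁
  set N₂ := ∑' m, ENNReal.ofReal (fracSymbol t₂ m) * b m ^ 2 with hN₂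
  set X : (d → ℤ) → ℝ≥0∞ := fun k => ∑' j, a (k - j) * b j with hX
  set R : ℝ≥0∞ := ENNReal.ofReal K * N₁ * N₂ with hR
  set Z : Set (d → ℤ) := {k : d → ℤ | k ≠ 0} with hZ
  -- the truncated terms, monotone in the truncation level
  set g : (d → ℤ) → ℝ≥0 → ℝ≥0∞ := fun k M =>
    Z.indicator (fun k => ENNReal.ofReal (fracSymbol σ k) * (min (X k) (M : ℝ≥0∞)) ^ 2) k with hg
  have hgmono : ∀ k, Monotone (g k) := by
    intro k M M' hMM'
    simp only [hg]
    by_cases hk : k ∈ Z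
    · rw [indicator_of_mem hk, indicator_of_mem hk]
      exact mul_le_mul' le_rfl (pow_le_pow_left' (min_le_min le_rfl (by exact_mod_cast hMM')) 2)
    · rw [indicator_of_notMem hk, indicator_of_notMem hk]
  have hgsup : ∀ k, ⨆ M, g k M =
      Z.indicator (fun k => ENNReal.ofReal (fracSymbol σ k) * X k ^ 2) k := by
    intro k
    simp only [hg]
    by_cases hk : k ∈ Z
    · simp only [indicator_of_mem hk]
      rw [← ENNReal.mul_iSup, iSup_min_coe_sq]
    · simp only [indicator_of_notMem hk, ciSup_const]
  -- ### the truncated finite sums are bounded by `R`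
  have htrunc : ∀ (F : Finset (d → ℤ)) (M : ℝ≥0), ∑ k ∈ F, g k M ≤ R := by
    intro F M
    set c : (d → ℤ) → ℝ≥0∞ := fun k => if k ∈ F then
      Z.indicator (fun k => ENNReal.ofReal (fracSymbol σ k) * min (X k) (M : ℝ≥0∞)) k else 0 with hc
    have hc0 : c 0 = 0 := by
      simp only [hc]
      split_ifs
      · exact indicator_of_notMem (by simp [hZ]) _
      · rfl
    set S : ℝ≥0∞ := ∑ k ∈ F, g k M with hS
    have hSfin : S ≠ ∞ := by
      refine (ENNReal.sum_lt_top.2 fun k _ => ?_).ne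
      simp only [hg]
      by_cases hk : k ∈ Z
      · rw [indicator_of_mem hk]
        exact ENNReal.mul_lt_top ENNReal.ofReal_lt_top
          (ENNReal.pow_lt_top (lt_of_le_of_lt (min_le_right _ _) ENNReal.coe_lt_top))
      · rw [indicator_of_notMem hk]; exact ENNReal.zero_lt_top
    -- `S ≤ T`
    have hST : S ≤ ∑' k, ∑' j, a (k - j) * b j * c k := by
      have e : ∑' k, ∑' j, a (k - j) * b j * c k = ∑' k, X k * c k :=
        tsum_congr fun k => by rw [ENNReal.tsum_mul_right]
      rw [e, hS, tsum_eq_sum (s := F) (f := fun k => X k * c k)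
        (fun k hk => by simp only [hc, if_neg hk, mul_zero])]
      refine Finset.sum_le_sum fun k hkF => ?_
      simp only [hg, hc, if_pos hkF]
      by_cases hk : k ∈ Z
      · rw [indicator_of_mem hk, indicator_of_mem hk]
        calc ENNReal.ofReal (fracSymbol σ k) * min (X k) (M : ℝ≥0∞) ^ 2
            = ENNReal.ofReal (fracSymbol σ k) * min (X k) (M : ℝ≥0∞) * min (X k) (M : ℝ≥0∞) := by ring
          _ ≤ ENNReal.ofReal (fracSymbol σ k) * min (X k) (M : ℝ≥0∞) * X k :=
              mul_le_mul' le_rfl (min_le_left _ _)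
          _ = X k * (ENNReal.ofReal (fracSymbol σ k) * min (X k) (M : ℝ≥0∞)) := by ring
      · rw [indicator_of_notMem hk, indicator_of_notMem hk, mul_zero]
    -- `∑ σ_{-σ} c² = S`
    have hN₃ : ∑' k, ENNReal.ofReal (fracSymbol (-σ) k) * c k ^ 2 = S := by
      rw [hS, tsum_eq_sum (s := F) (f := fun k => ENNReal.ofReal (fracSymbol (-σ) k) * c k ^ 2)
        (fun k hk => by simp only [hc, if_neg hk]; simp)]
      refine Finset.sum_congr rfl fun k hkF => ?_
      simp only [hg, hc, if_pos hkF]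
      by_cases hk : k ∈ Z
      · rw [indicator_of_mem hk, indicator_of_mem hk, mul_pow, ← ENNReal.ofReal_pow (fracSymbol_nonneg _ _),
          ← mul_assoc, ← ENNReal.ofReal_mul (fracSymbol_nonneg _ _), sq, ← mul_assoc,
          fracSymbol_neg_mul_self hk σ, one_mul]
      · rw [indicator_of_notMem hk, indicator_of_notMem hk]; simp
    -- cancel `S`
    have h5 : S * S ≤ R * S := by
      calc S * S = S ^ 2 := (sq S).symm
        _ ≤ (∑' k, ∑' j, a (k - j) * b j * c k) ^ 2 := pow_le_pow_left' hST 2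
        _ ≤ ENNReal.ofReal K * N₁ * N₂ * ∑' k, ENNReal.ofReal (fracSymbol (-σ) k) * c k ^ 2 :=
            hT a b c ha hb hc0
        _ = R * S := by rw [hN₃]
    by_cases hS0 : S = 0
    · rw [hS0]; exact zero_le
    · exact (ENNReal.mul_le_mul_iff_left hS0 hSfin).1 h5
  -- ### monotone convergence in the truncation level and over finite sets of frequencies
  calc ∑' k : d → ℤ, Z.indicator (fun k => ENNReal.ofReal (fracSymbol σ k) * (∑' j, a (k - j) * b j) ^ 2) k
      = ∑' k, ⨆ M, g k M := tsum_congr fun k => (hgsup k).symm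
    _ = ⨆ F : Finset (d → ℤ), ∑ k ∈ F, ⨆ M, g k M := ENNReal.tsum_eq_iSup_sum
    _ ≤ R := iSup_le fun F => by
        rw [ENNReal.finsetSum_iSup_of_monotone fun k => hgmono k]
        exact iSup_le fun M => htrunc F M

end LatticeTrilinear

end Summit.NavierStokesRegularity.FunctionalMining
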